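import Summits.QuantumFields.YangMills.Theorems.BalabanLadderNTWeakPackageOfFloor
import Summits.QuantumFields.YangMills.Theorems.LangevinControlUVOSLegsFromFemtoAndGapStubCollar6
import Summits.QuantumFields.YangMills.Theorems.LangevinControlUVOSLegsAtWeakCouplingCFblOfFbl6
import HarnessLib

/-!
# Crux `NT` (stmt-QuantumFields-19353): BOTH lattice legs (floors ∧ plane-resolved ceilings) from the plane-resolved floor package

Helper file (`--supports stmt-QuantumFields-19353`) of the fleet lead prover of crux `NT` (unit `ym-spine-19353-p1`,
g2).  At the R85 edit of route `BalabanLadder` (owner ym-beyond-p2 g20, 2026-08-26 17:18Z) the ∀-`G` crux `NT` goes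
`aside` and «∃ unit carrying floors (∧ ceilings)» lives inside each group class's item: `UVSeamRec` (SU(2), unit of
record), `UVSeamWitnessSUN` (SU(N ≥ 3)), `UVNonSUNRec` (no SU(N)) — the latter two in the shape
`∃ (r : LatticeRep G) (a : ℝ → ℝ), (∀ β, 0 < a β) ∧ a → 0 ∧ LowerBounds G r a ∧ MomentBounds6 G r a`.
This file records the femto discharge of that shape from the PLANE-RESOLVED floor package at one `(G, r, a)`:
`FBL6` (plane-resolved boundary law; reducible to the central site of centred cubes and the `(0,1)` orientation,
`BoundaryLaw.fbl6_of_centred`) ∧ (F) ∧ (T):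

* `legs_of_floorPackage6` — `(∀ β, 0 < a β) → a → 0 → FBL6 → (F) → (T) → LowerBounds G r a ∧ MomentBounds6 G r a`
  (`fbl_of_fbl6`, `lowerBounds_of_floorPackage`, landed `stub_collar6`);
* `recBody_of_floorPackage6` — the `∃ (r, a)` body of `UVNonSUNRec` / the legs of `UVSeamWitnessSUN` for a compact
  simple `G` from `∃ (r, a), units ∧ FBL6 ∧ (F) ∧ (T)`.
-/

set_option autoImplicit false

noncomputable section

open MeasureTheory Filter Topology
open Literature.MathematicalPhysics.QuantumFieldTheory Literature.MathematicalPhysics.QuantumLattice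
open Literature.Probability.LatticeModels
open Summit.QuantumFields.YangMills.Cruxes.OSLegsFromFemtoAndGap.DlrCollarTransfer

namespace Summit.QuantumFields.YangMills.Cruxes.NT.WeakPackage

section Lattice

variable (G : Type) [Group G] [TopologicalSpace G] [IsTopologicalGroup G] [CompactSpace G]
  [MeasurableSpace G] [BorelSpace G] (r : LatticeRep G) (a : ℝ → ℝ)

/-- **Both lattice legs from the plane-resolved floor package at one `(G, r, a)`**: the plane-resolved femto boundary law
`FBL6`, the weak floor clause (F) and the weak third-cumulant clause (T) give the `k`-free lower bounds `LowerBounds G r a`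
(`fbl_of_fbl6` + `lowerBounds_of_floorPackage`) and the plane-resolved centred-moment ceilings `MomentBounds6 G r a`
(landed `stub_collar6`). [folklore] -/
theorem legs_of_floorPackage6 (hapos : ∀ β, 0 < a β) (hlim : Tendsto a atTop (𝓝 0)) (hFBL6 : FBL6 G r a)
    (hF : ∃ (Γ : ℝ → ℝ) (β₂ ℓ₂ c₂ : ℝ) (K : ℝ → ℝ) (n₀ : ℕ), 0 < ℓ₂ ∧ 0 < c₂ ∧ (∀ s, 1 ≤ K s) ∧
      Tendsto (fun s : ℝ => s * K s) (nhdsWithin 0 (Set.Ioi 0)) (nhds 0) ∧ 1 ≤ n₀ ∧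
      Tendsto (fun s : ℝ => Γ s / s ^ 8) (nhdsWithin 0 (Set.Ioi 0)) atTop ∧
      ∀ β : ℝ, β₂ ≤ β → ∀ (x : Fin 4 → ℤ) (R : ℕ), ((2 * R + 1 : ℕ) : ℝ) * a β ≤ ℓ₂ →
        ∀ (η : LGConfig 4 G) (y : Fin 4 → ℤ) (s₀ : ℝ), 0 < s₀ → s₀ ≤ ‖siteToE (y - x)‖ * a β →
          (n₀ : ℝ) ≤ ‖siteToE (y - x)‖ → ‖siteToE (y - x)‖ < 3 * siteToE (y - x) 0 →
            K s₀ * ‖siteToE (y - x)‖ ≤ depth (fun j => x j - R) (2 * R + 1) y →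
              c₂ * Γ (‖siteToE (y - x)‖ * a β) ≤
                ‖siteToE (y - x)‖ ^ 8 *
                  kerCov G r β (fun j => x j - R) (2 * R + 1) η (dens G r x) (dens G r y))
    (hT : ∃ (v w : EuclideanSpace ℝ (Fin 4)) (σ δ : ℝ) (Γ₃ : ℝ → ℝ) (β₃ ℓ₃ c₃ : ℝ) (K₃ : ℝ → ℝ) (n₃ : ℕ),
      (σ = 1 ∨ σ = -1) ∧ 0 < δ ∧ 2 * δ < ‖v‖ ∧ 2 * δ < ‖w‖ ∧ 2 * δ < ‖v - w‖ ∧ 0 < ℓ₃ ∧ 0 < c₃ ∧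
      (∀ s, 1 ≤ K₃ s) ∧ Tendsto (fun s : ℝ => s * K₃ s) (nhdsWithin 0 (Set.Ioi 0)) (nhds 0) ∧
      Tendsto (fun s : ℝ => Γ₃ s / s ^ 4) (nhdsWithin 0 (Set.Ioi 0)) atTop ∧
      ∀ β : ℝ, β₃ ≤ β → ∀ (x : Fin 4 → ℤ) (R : ℕ), ((2 * R + 1 : ℕ) : ℝ) * a β ≤ ℓ₃ →
        ∀ (η : LGConfig 4 G) (n : ℕ) (y z : Fin 4 → ℤ) (s₀ : ℝ), 0 < s₀ → s₀ ≤ (n : ℝ) * a β →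
          n₃ ≤ n → ‖siteToE (y - x) - (n : ℝ) • v‖ ≤ δ * n → ‖siteToE (z - x) - (n : ℝ) • w‖ ≤ δ * n →
            K₃ s₀ * n ≤ depth (fun j => x j - R) (2 * R + 1) x →
            K₃ s₀ * n ≤ depth (fun j => x j - R) (2 * R + 1) y →
            K₃ s₀ * n ≤ depth (fun j => x j - R) (2 * R + 1) z →
              c₃ * Γ₃ ((n : ℝ) * a β) ≤
                σ * (n : ℝ) ^ 12 * kerK3 G r β (fun j => x j - R) (2 * R + 1) η x y z) :
    LowerBounds G r a ∧ MomentBounds6 G r a :=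
  ⟨lowerBounds_of_floorPackage G r a hapos hlim (fbl_of_fbl6 r a hFBL6) hF hT, stub_collar6 G r a hFBL6⟩

end Lattice

/-- **The `∃ (r, a)` legs body of a group class from the plane-resolved floor package** (shape of the residual items
`UVNonSUNRec` / `UVSeamWitnessSUN` of the R85 edit, for ONE compact group `G` with its Borel σ-algebra): if some
`(r, a)` carries `units ∧ FBL6 ∧ (F) ∧ (T)` then some `(r, a)` carries
`(∀ β, 0 < a β) ∧ a → 0 ∧ LowerBounds G r a ∧ MomentBounds6 G r a`. [folklore] -/
theorem recBody_of_floorPackage6 (G : Type) [Group G] [TopologicalSpace G] [IsTopologicalGroup G] [CompactSpace G]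
    [MeasurableSpace G] [BorelSpace G]
    (h : ∃ (r : LatticeRep G) (a : ℝ → ℝ), (∀ β, 0 < a β) ∧ Tendsto a atTop (𝓝 0) ∧ FBL6 G r a ∧
      (∃ (Γ : ℝ → ℝ) (β₂ ℓ₂ c₂ : ℝ) (K : ℝ → ℝ) (n₀ : ℕ), 0 < ℓ₂ ∧ 0 < c₂ ∧ (∀ s, 1 ≤ K s) ∧
      Tendsto (fun s : ℝ => s * K s) (nhdsWithin 0 (Set.Ioi 0)) (nhds 0) ∧ 1 ≤ n₀ ∧
      Tendsto (fun s : ℝ => Γ s / s ^ 8) (nhdsWithin 0 (Set.Ioi 0)) atTop ∧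
      ∀ β : ℝ, β₂ ≤ β → ∀ (x : Fin 4 → ℤ) (R : ℕ), ((2 * R + 1 : ℕ) : ℝ) * a β ≤ ℓ₂ →
        ∀ (η : LGConfig 4 G) (y : Fin 4 → ℤ) (s₀ : ℝ), 0 < s₀ → s₀ ≤ ‖siteToE (y - x)‖ * a β →
          (n₀ : ℝ) ≤ ‖siteToE (y - x)‖ → ‖siteToE (y - x)‖ < 3 * siteToE (y - x) 0 →
            K s₀ * ‖siteToE (y - x)‖ ≤ depth (fun j => x j - R) (2 * R + 1) y →
              c₂ * Γ (‖siteToE (y - x)‖ * a β) ≤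
                ‖siteToE (y - x)‖ ^ 8 *
                  kerCov G r β (fun j => x j - R) (2 * R + 1) η (dens G r x) (dens G r y)) ∧
      (∃ (v w : EuclideanSpace ℝ (Fin 4)) (σ δ : ℝ) (Γ₃ : ℝ → ℝ) (β₃ ℓ₃ c₃ : ℝ) (K₃ : ℝ → ℝ) (n₃ : ℕ),
      (σ = 1 ∨ σ = -1) ∧ 0 < δ ∧ 2 * δ < ‖v‖ ∧ 2 * δ < ‖w‖ ∧ 2 * δ < ‖v - w‖ ∧ 0 < ℓ₃ ∧ 0 < c₃ ∧
      (∀ s, 1 ≤ K₃ s) ∧ Tendsto (fun s : ℝ => s * K₃ s) (nhdsWithin 0 (Set.Ioi 0)) (nhds 0) ∧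
      Tendsto (fun s : ℝ => Γ₃ s / s ^ 4) (nhdsWithin 0 (Set.Ioi 0)) atTop ∧
      ∀ β : ℝ, β₃ ≤ β → ∀ (x : Fin 4 → ℤ) (R : ℕ), ((2 * R + 1 : ℕ) : ℝ) * a β ≤ ℓ₃ →
        ∀ (η : LGConfig 4 G) (n : ℕ) (y z : Fin 4 → ℤ) (s₀ : ℝ), 0 < s₀ → s₀ ≤ (n : ℝ) * a β →
          n₃ ≤ n → ‖siteToE (y - x) - (n : ℝ) • v‖ ≤ δ * n → ‖siteToE (z - x) - (n : ℝ) • w‖ ≤ δ * n →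
            K₃ s₀ * n ≤ depth (fun j => x j - R) (2 * R + 1) x →
            K₃ s₀ * n ≤ depth (fun j => x j - R) (2 * R + 1) y →
            K₃ s₀ * n ≤ depth (fun j => x j - R) (2 * R + 1) z →
              c₃ * Γ₃ ((n : ℝ) * a β) ≤
                σ * (n : ℝ) ^ 12 * kerK3 G r β (fun j => x j - R) (2 * R + 1) η x y z)) :
    ∃ (r : LatticeRep G) (a : ℝ → ℝ), (∀ β, 0 < a β) ∧ Tendsto a atTop (𝓝 0) ∧
      LowerBounds G r a ∧ MomentBounds6 G r a := by
  obtain ⟨r, a, ha, ha0, h6, hF, hT⟩ := h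
  exact ⟨r, a, ha, ha0, legs_of_floorPackage6 G r a ha ha0 h6 hF hT⟩

end Summit.QuantumFields.YangMills.Cruxes.NT.WeakPackage

end
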